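import Mathlib.Analysis.Normed.Unbundled.SmoothingSeminorm
import Mathlib.Data.Real.Pointwise
import Mathlib.Order.Zorn
import HarnessLib

/-!
# Multiplicative seminorms below a non-archimedean ring seminorm (non-emptiness of the Berkovich spectrum)

Let `R` be a commutative ring and `q` a NON-ARCHIMEDEAN ring seminorm on `R` with `q 1 = 1`. Then there is a
MULTIPLICATIVE non-archimedean ring seminorm `N` on `R` (`N 1 = 1`, `N (x * y) = N x * N y`) with `N ≤ q`
pointwise (`exists_mulRingSeminorm_le`). For a Banach ring this is the non-emptiness of the Berkovich (Gelfand)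
spectrum [Berkovich 1990, Thm. 1.2.1], [Kedlaya 2022, Lemma 23.3.3 / Thm. 23.3.4: «Let `S` be the set of nonzero
bounded submultiplicative seminorms … (a) `S` contains at least one minimal element. (b) Any minimal element of `S` is
multiplicative.»]; the notion goes back to Guennebaud (Kedlaya, loc. cit., Notes).

The proof given here is the elementary minimal-seminorm argument and uses NO completeness (and no reduction to a
field), which is why the statement is for a bare commutative ring with a non-archimedean seminorm:
1. (`exists_ringSeminorm_le_chain`, `exists_minimal_ringSeminorm_le`) Zorn's lemma: the pointwise infimum of a chain
   of non-archimedean ring seminorms `p ≤ q` with `p 1 = 1` is again one, so a pointwise-MINIMAL such `p₀` exists.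
2. (`isPowMul_of_minimal`) Mathlib's smoothing seminorm `x ↦ lim p₀(xⁿ)^{1/n}` (`smoothingSeminorm`, power-multiplicative,
   non-archimedean, `≤ p₀`, value `1` at `1`) lies below `p₀`, hence equals it: `p₀` is power-multiplicative.
3. (`map_mul_of_minimal`) for `p₀ f ≠ 0` the function `g ↦ inf_n p₀(g fⁿ)/p₀(f)ⁿ` is a non-archimedean ring seminorm
   `≤ p₀` with value `1` at `1` (power-multiplicativity), hence equals `p₀`; in particular `p₀ g ≤ p₀(g f)/p₀ f`, i.e.
   `p₀ (g f) = p₀ g · p₀ f`.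

Used by the abc-iut cell (branch E, [J-III] Lemma 7.6.4.1: a multiplicative «tensor product norm») but stated and
proved as plain valuation theory / Banach algebra. No instance, notation or axiom.
-/

noncomputable section

open Filter
open scoped _root_.Topology

namespace Literature.RingTheory.Valuation

variable {R : Type*} [CommRing R]

/-! ## 1. Chains of dominated seminorms have lower bounds -/

/-- **Infimum of a chain.** Let `q` be a ring seminorm on a commutative ring and `c` a nonempty, totally ordered
(pointwise) family of functions each of which is (the coercion of) a non-archimedean ring seminorm `p ≤ q` with
`p 1 = 1`. Then the pointwise infimum of `c` is again such a seminorm: there is a non-archimedean ring seminorm `p ≤ q`,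
`p 1 = 1`, lying below every member of `c` — the chain step of [Kedlaya 2022, Lemma 23.3.3 (a)] «S contains at least
one minimal element … apply Zorn's lemma», here for non-archimedean seminorms on a commutative ring.
[cite: Kedlaya2022, Lemma 23.3.3 (a)] -/
theorem exists_ringSeminorm_le_chain (q : RingSeminorm R) {c : Set (R → ℝ)} (hne : c.Nonempty)
    (htot : ∀ f ∈ c, ∀ g ∈ c, f ≤ g ∨ g ≤ f)
    (hcs : ∀ f ∈ c, ∃ p : RingSeminorm R, ⇑p = f ∧ IsNonarchimedean p ∧ p 1 = 1 ∧ ∀ x, p x ≤ q x) :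
    ∃ p : RingSeminorm R, IsNonarchimedean p ∧ p 1 = 1 ∧ (∀ x, p x ≤ q x) ∧ ∀ f ∈ c, ∀ x, p x ≤ f x := by
  haveI : Nonempty c := hne.to_subtype
  -- members are non-negative
  have h0 : ∀ f : c, ∀ x, 0 ≤ f.1 x := fun f x => by
    obtain ⟨p, hp, -⟩ := hcs f.1 f.2
    rw [← hp]
    exact apply_nonneg p x
  have hbdd : ∀ x, BddBelow (Set.range fun f : c => f.1 x) := fun x =>
    ⟨0, by rintro _ ⟨f, rfl⟩; exact h0 f x⟩
  -- the pointwise infimum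
  let g : R → ℝ := fun x => ⨅ f : c, f.1 x
  have hg_le : ∀ (f : c) (x), g x ≤ f.1 x := fun f x => ciInf_le (hbdd x) f
  have hg_nonneg : ∀ x, 0 ≤ g x := fun x => le_ciInf fun f => h0 f x
  -- below any two members of the chain lies a member of the chain
  have hdir : ∀ f₁ f₂ : c, ∃ f : c, f.1 ≤ f₁.1 ∧ f.1 ≤ f₂.1 := fun f₁ f₂ => by
    rcases htot f₁.1 f₁.2 f₂.1 f₂.2 with h | h
    · exact ⟨f₁, le_rfl, h⟩
    · exact ⟨f₂, h, le_rfl⟩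
  have hconst : ∀ {x : R} {a : ℝ}, (∀ f : c, f.1 x = a) → g x = a := fun {x a} h => by
    show (⨅ f : c, f.1 x) = a
    rw [iInf_congr h]
    exact ciInf_const
  have hg0 : g 0 = 0 := hconst fun f => by
    obtain ⟨p, hp, -⟩ := hcs f.1 f.2
    rw [← hp]
    exact map_zero p
  have hg1 : g 1 = 1 := hconst fun f => by
    obtain ⟨p, hp, -, hp1, -⟩ := hcs f.1 f.2
    rw [← hp]
    exact hp1
  have hgneg : ∀ x, g (-x) = g x := fun x => by
    show (⨅ f : c, f.1 (-x)) = ⨅ f : c, f.1 x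
    exact iInf_congr fun f => by
      obtain ⟨p, hp, -⟩ := hcs f.1 f.2
      rw [← hp]
      exact map_neg_eq_map p x
  have hgq : ∀ x, g x ≤ q x := fun x => by
    obtain ⟨f⟩ := ‹Nonempty c›
    obtain ⟨p, hp, -, -, hpq⟩ := hcs f.1 f.2
    exact (hg_le f x).trans (by rw [← hp]; exact hpq x)
  have hgna : IsNonarchimedean g := fun x y => by
    by_contra h
    push Not at h
    obtain ⟨f₁, hf₁⟩ := exists_lt_of_ciInf_lt ((le_max_left _ _).trans_lt h)
    obtain ⟨f₂, hf₂⟩ := exists_lt_of_ciInf_lt ((le_max_right _ _).trans_lt h)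
    obtain ⟨f, hf1, hf2⟩ := hdir f₁ f₂
    obtain ⟨p, hp, hpna, -⟩ := hcs f.1 f.2
    have hf : f.1 (x + y) ≤ max (f.1 x) (f.1 y) := by
      rw [← hp]
      exact hpna x y
    exact (lt_irrefl _) <|
      calc g (x + y) ≤ f.1 (x + y) := hg_le f _
        _ ≤ max (f.1 x) (f.1 y) := hf
        _ < g (x + y) := max_lt ((hf1 x).trans_lt hf₁) ((hf2 y).trans_lt hf₂)
  have hgmul : ∀ x y, g (x * y) ≤ g x * g y := fun x y => by
    have key : ∀ δ : ℝ, 0 < δ → g (x * y) ≤ (g x + δ) * (g y + δ) := fun δ hδ => by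
      obtain ⟨f₁, hf₁⟩ := exists_lt_of_ciInf_lt (lt_add_of_pos_right (g x) hδ)
      obtain ⟨f₂, hf₂⟩ := exists_lt_of_ciInf_lt (lt_add_of_pos_right (g y) hδ)
      obtain ⟨f, hf1, hf2⟩ := hdir f₁ f₂
      obtain ⟨p, hp, -, -⟩ := hcs f.1 f.2
      have hmul : f.1 (x * y) ≤ f.1 x * f.1 y := by
        rw [← hp]
        exact map_mul_le_mul p x y
      calc g (x * y) ≤ f.1 (x * y) := hg_le f _
        _ ≤ f.1 x * f.1 y := hmul
        _ ≤ (g x + δ) * (g y + δ) :=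
          mul_le_mul ((hf1 x).trans hf₁.le) ((hf2 y).trans hf₂.le) (h0 f y)
            (by linarith [hg_nonneg x])
    have ht : Tendsto (fun δ : ℝ => (g x + δ) * (g y + δ)) (𝓝[>] 0) (𝓝 (g x * g y)) := by
      have h : Tendsto (fun δ : ℝ => (g x + δ) * (g y + δ)) (𝓝 0) (𝓝 ((g x + 0) * (g y + 0))) :=
        (tendsto_const_nhds.add tendsto_id).mul (tendsto_const_nhds.add tendsto_id)
      rw [add_zero, add_zero] at h
      exact h.mono_left nhdsWithin_le_nhds
    exact ge_of_tendsto ht (eventually_nhdsWithin_of_forall fun δ hδ => key δ hδ)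
  let pg : RingSeminorm R :=
    { toFun := g
      map_zero' := hg0
      add_le' := fun x y => hgna.add_le hg_nonneg
      neg' := hgneg
      mul_le' := hgmul }
  exact ⟨pg, hgna, hg1, hgq, fun f hf x => hg_le ⟨f, hf⟩ x⟩

/-- **Minimal dominated seminorm** ([Kedlaya 2022, Lemma 23.3.3 (a)], here for non-archimedean seminorms on a
commutative ring, no completeness): below a non-archimedean ring seminorm `q` with `q 1 = 1` there is a
non-archimedean ring seminorm `p₀ ≤ q` with `p₀ 1 = 1` which is POINTWISE MINIMAL among all non-archimedean ring
seminorms `p` with `p 1 = 1` lying below it. (Zorn's lemma on the reverse pointwise order, chains bounded by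
`exists_ringSeminorm_le_chain`.) [cite: Kedlaya2022, Lemma 23.3.3 (a)] -/
theorem exists_minimal_ringSeminorm_le (q : RingSeminorm R) (hq : IsNonarchimedean q) (hq1 : q 1 = 1) :
    ∃ p₀ : RingSeminorm R, IsNonarchimedean p₀ ∧ p₀ 1 = 1 ∧ (∀ x, p₀ x ≤ q x) ∧
      ∀ p : RingSeminorm R, IsNonarchimedean p → p 1 = 1 → (∀ x, p x ≤ p₀ x) → ∀ x, p₀ x ≤ p x := by
  -- admissible functions, in the REVERSED pointwise order (Zorn's maximal element = pointwise minimal seminorm)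
  let s : Set (R → ℝ)ᵒᵈ :=
    {f | ∃ p : RingSeminorm R, ⇑p = OrderDual.ofDual f ∧ IsNonarchimedean p ∧ p 1 = 1 ∧ ∀ x, p x ≤ q x}
  have hqs : OrderDual.toDual (⇑q) ∈ s := ⟨q, rfl, hq, hq1, fun _ => le_rfl⟩
  have ih : ∀ c ⊆ s, IsChain (· ≤ ·) c → ∀ y ∈ c, ∃ ub ∈ s, ∀ z ∈ c, z ≤ ub := by
    intro c hcs hc y hy
    have htot : ∀ f ∈ OrderDual.ofDual '' c, ∀ g ∈ OrderDual.ofDual '' c, f ≤ g ∨ g ≤ f := by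
      rintro _ ⟨f, hf, rfl⟩ _ ⟨g, hg, rfl⟩
      rcases eq_or_ne f g with rfl | hne
      · exact Or.inl le_rfl
      rcases hc hf hg hne with h | h
      · exact Or.inr (OrderDual.ofDual_le_ofDual.2 h)
      · exact Or.inl (OrderDual.ofDual_le_ofDual.2 h)
    have hcs' : ∀ f ∈ OrderDual.ofDual '' c,
        ∃ p : RingSeminorm R, ⇑p = f ∧ IsNonarchimedean p ∧ p 1 = 1 ∧ ∀ x, p x ≤ q x := by
      rintro _ ⟨f, hf, rfl⟩
      exact hcs hf
    obtain ⟨p, hpna, hp1, hpq, hpc⟩ :=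
      exists_ringSeminorm_le_chain q (Set.Nonempty.image OrderDual.ofDual ⟨y, hy⟩) htot hcs'
    refine ⟨OrderDual.toDual ⇑p, ⟨p, rfl, hpna, hp1, hpq⟩, fun z hz => ?_⟩
    exact OrderDual.le_toDual.2 fun x => hpc _ ⟨z, hz, rfl⟩ x
  obtain ⟨m, -, hm⟩ := zorn_le_nonempty₀ s ih _ hqs
  obtain ⟨p₀, hp₀, hna, h1, hle⟩ := hm.1
  refine ⟨p₀, hna, h1, hle, fun p hp hp1 hpp₀ x => ?_⟩
  have hps : OrderDual.toDual ⇑p ∈ s := ⟨p, rfl, hp, hp1, fun y => (hpp₀ y).trans (hle y)⟩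
  have h2 : m ≤ OrderDual.toDual ⇑p := OrderDual.le_toDual.2 (by rw [← hp₀]; exact hpp₀)
  have h4 : OrderDual.ofDual m ≤ ⇑p := OrderDual.toDual_le.1 (hm.2 hps h2)
  rw [← hp₀] at h4
  exact h4 x

/-! ## 2. A minimal seminorm is power-multiplicative -/

/-- Mathlib's smoothing seminorm, applied: `smoothingSeminorm μ _ _ x = smoothingFun μ x` (plumbing). [folklore] -/
private theorem smoothingSeminorm_apply (μ : RingSeminorm R) (h1 : μ 1 ≤ 1) (hna : IsNonarchimedean μ) (x : R) :
    smoothingSeminorm μ h1 hna x = smoothingFun μ x := rfl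

/-- **A minimal seminorm is power-multiplicative** ([Kedlaya 2022, Lemma 23.3.3 (b), first step «|r| = |r|_sp»],
here via Mathlib's `smoothingSeminorm`): if `p₀` (non-archimedean, `p₀ 1 = 1`) is pointwise minimal among the
non-archimedean ring seminorms `p ≤ p₀` with `p 1 = 1`, then the power-multiplicative smoothing
`x ↦ lim p₀(xⁿ)^{1/n} ≤ p₀` equals `p₀`, so `p₀ (aⁿ) = (p₀ a)ⁿ`. [cite: Kedlaya2022, Lemma 23.3.3 (b)] -/
theorem isPowMul_of_minimal {p₀ : RingSeminorm R} (hna : IsNonarchimedean p₀) (h1 : p₀ 1 = 1)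
    (hmin : ∀ p : RingSeminorm R, IsNonarchimedean p → p 1 = 1 → (∀ x, p x ≤ p₀ x) → ∀ x, p₀ x ≤ p x) :
    IsPowMul p₀ := by
  have h1' : p₀ 1 ≤ 1 := h1.le
  have hρ1 : smoothingSeminorm p₀ h1' hna 1 = 1 := by
    rw [smoothingSeminorm_apply,
      smoothingFun_of_powMul p₀ h1' (x := 1) (fun n _ => by rw [one_pow, h1, one_pow]), h1]
  have hle : ∀ x, p₀ x ≤ smoothingFun p₀ x :=
    hmin (smoothingSeminorm p₀ h1' hna) (isNonarchimedean_smoothingFun p₀ h1' hna) hρ1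
      (fun x => smoothingFun_le_self p₀ x)
  have heq : ∀ x, p₀ x = smoothingFun p₀ x := fun x =>
    le_antisymm (hle x) (smoothingFun_le_self p₀ x)
  intro a n hn
  rw [heq, heq a]
  exact isPowMul_smoothingFun p₀ h1' a hn

/-! ## 3. A minimal seminorm is multiplicative -/

/-- **A minimal seminorm is multiplicative** ([Kedlaya 2022, Lemma 23.3.3 (b)]; [Berkovich 1990, proof of
Thm. 1.2.1]): with `p₀` minimal as in `isPowMul_of_minimal` and power-multiplicative, for `p₀ f ≠ 0` the function
`g ↦ inf_n p₀(g fⁿ)/p₀(f)ⁿ` is a non-archimedean ring seminorm `≤ p₀` taking the value `1` at `1`, so by minimality it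
is `≥ p₀`; its first term gives `p₀ g · p₀ f ≤ p₀ (g f)`, whence `p₀ (g f) = p₀ g · p₀ f` (the case `p₀ f = 0` being
trivial). [cite: Kedlaya2022, Lemma 23.3.3 (b)] -/
theorem map_mul_of_minimal {p₀ : RingSeminorm R} (hna : IsNonarchimedean p₀) (h1 : p₀ 1 = 1)
    (hpm : IsPowMul p₀)
    (hmin : ∀ p : RingSeminorm R, IsNonarchimedean p → p 1 = 1 → (∀ x, p x ≤ p₀ x) → ∀ x, p₀ x ≤ p x)
    (x f : R) : p₀ (x * f) = p₀ x * p₀ f := by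
  rcases eq_or_ne (p₀ f) 0 with hf | hf
  · rw [hf, mul_zero]
    exact le_antisymm ((map_mul_le_mul p₀ x f).trans (by rw [hf, mul_zero])) (apply_nonneg p₀ _)
  have hf0 : 0 < p₀ f := lt_of_le_of_ne (apply_nonneg p₀ f) hf.symm
  -- the decreasing sequence `a n g = p₀ (g fⁿ) / p₀ f ^ n`
  let a : ℕ → R → ℝ := fun n g => p₀ (g * f ^ n) / p₀ f ^ n
  have ha_nonneg : ∀ n g, 0 ≤ a n g := fun n g => div_nonneg (apply_nonneg p₀ _) (pow_nonneg hf0.le n)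
  have ha0 : ∀ g, a 0 g = p₀ g := fun g => by simp [a]
  have ha_succ : ∀ n g, a (n + 1) g ≤ a n g := fun n g => by
    have hle : p₀ (g * f ^ (n + 1)) ≤ p₀ (g * f ^ n) * p₀ f := by
      rw [pow_succ, ← mul_assoc]
      exact map_mul_le_mul p₀ _ _
    calc a (n + 1) g = p₀ (g * f ^ (n + 1)) / (p₀ f ^ n * p₀ f) := by simp only [a, pow_succ]
      _ ≤ p₀ (g * f ^ n) * p₀ f / (p₀ f ^ n * p₀ f) := div_le_div_of_nonneg_right hle (by positivity)
      _ = a n g := by rw [mul_div_mul_right _ _ hf]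
  have ha_anti : ∀ g, Antitone fun n => a n g := fun g => antitone_nat_of_succ_le fun n => ha_succ n g
  have hbdd : ∀ g, BddBelow (Set.range fun n => a n g) := fun g =>
    ⟨0, by rintro _ ⟨n, rfl⟩; exact ha_nonneg n g⟩
  -- its infimum `h`
  let h : R → ℝ := fun g => ⨅ n, a n g
  have hh_le_a : ∀ n g, h g ≤ a n g := fun n g => ciInf_le (hbdd g) n
  have hh_le : ∀ g, h g ≤ p₀ g := fun g => (hh_le_a 0 g).trans (ha0 g).le
  have hh_nonneg : ∀ g, 0 ≤ h g := fun g => le_ciInf fun n => ha_nonneg n g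
  have hh0 : h 0 = 0 := by
    show (⨅ n, a n 0) = 0
    have h' : (fun n => a n 0) = fun _ => 0 := funext fun n => by simp [a]
    rw [h', ciInf_const]
  have hh1 : h 1 = 1 := by
    show (⨅ n, a n 1) = 1
    have h' : (fun n => a n 1) = fun _ => 1 := funext fun n => by
      rcases Nat.eq_zero_or_pos n with rfl | hn
      · simp [a, h1]
      · simp only [a, one_mul]
        rw [hpm f hn, div_self (pow_ne_zero n hf)]
    rw [h', ciInf_const]
  have hhneg : ∀ g, h (-g) = h g := fun g => by
    show (⨅ n, a n (-g)) = ⨅ n, a n g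
    exact iInf_congr fun n => by simp only [a, neg_mul, map_neg_eq_map]
  have hhna : IsNonarchimedean h := fun x y => by
    by_contra hc
    push Not at hc
    obtain ⟨n₁, hn₁⟩ := exists_lt_of_ciInf_lt ((le_max_left _ _).trans_lt hc)
    obtain ⟨n₂, hn₂⟩ := exists_lt_of_ciInf_lt ((le_max_right _ _).trans_lt hc)
    have han : a (max n₁ n₂) (x + y) ≤ max (a (max n₁ n₂) x) (a (max n₁ n₂) y) := by
      simp only [a, add_mul]
      rw [max_div_div_right (pow_nonneg hf0.le _)]
      exact div_le_div_of_nonneg_right (hna _ _) (pow_nonneg hf0.le _)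
    exact (lt_irrefl _) <|
      calc h (x + y) ≤ a (max n₁ n₂) (x + y) := hh_le_a _ _
        _ ≤ max (a (max n₁ n₂) x) (a (max n₁ n₂) y) := han
        _ < h (x + y) :=
          max_lt ((ha_anti x (le_max_left n₁ n₂)).trans_lt hn₁)
            ((ha_anti y (le_max_right n₁ n₂)).trans_lt hn₂)
  have hhmul : ∀ x y, h (x * y) ≤ h x * h y := fun x y => by
    have hxy : ∀ n m, h (x * y) ≤ a n x * a m y := fun n m => by
      refine (hh_le_a (n + m) (x * y)).trans ?_
      have hle : p₀ (x * y * f ^ (n + m)) ≤ p₀ (x * f ^ n) * p₀ (y * f ^ m) := by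
        rw [pow_add, mul_mul_mul_comm]
        exact map_mul_le_mul p₀ _ _
      calc a (n + m) (x * y) = p₀ (x * y * f ^ (n + m)) / (p₀ f ^ n * p₀ f ^ m) := by
            simp only [a, pow_add]
        _ ≤ p₀ (x * f ^ n) * p₀ (y * f ^ m) / (p₀ f ^ n * p₀ f ^ m) :=
            div_le_div_of_nonneg_right hle (by positivity)
        _ = a n x * a m y := by rw [div_mul_div_comm]
    calc h (x * y) ≤ ⨅ n, ⨅ m, a n x * a m y := le_ciInf fun n => le_ciInf fun m => hxy n m
      _ = ⨅ n, a n x * h y := iInf_congr fun n => by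
          show (⨅ m, a n x * a m y) = a n x * ⨅ m, a m y
          rw [Real.mul_iInf_of_nonneg (ha_nonneg n x)]
      _ = h x * h y := by
          show (⨅ n, a n x * h y) = (⨅ n, a n x) * h y
          rw [Real.iInf_mul_of_nonneg (hh_nonneg y)]
  -- `h` is admissible and `≤ p₀`: minimality forces `p₀ ≤ h ≤ a 1`
  let ph : RingSeminorm R :=
    { toFun := h
      map_zero' := hh0
      add_le' := fun x y => hhna.add_le hh_nonneg
      neg' := hhneg
      mul_le' := hhmul }
  have hge : ∀ g, p₀ g ≤ h g := hmin ph hhna hh1 hh_le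
  have key : p₀ x ≤ p₀ (x * f) / p₀ f := by
    have h' := (hge x).trans (hh_le_a 1 x)
    simpa [a] using h'
  rw [le_div_iff₀ hf0] at key
  exact le_antisymm (map_mul_le_mul p₀ x f) key

/-! ## 4. The theorem -/

/-- **Non-emptiness of the Berkovich spectrum, non-archimedean seminormed form** [Berkovich 1990, Thm. 1.2.1: «The
spectrum `M(A)` of a nonzero Banach ring is nonempty»]; [Kedlaya 2022, Lemma 23.3.3 / Thm. 23.3.4]: below every
non-archimedean ring seminorm `q` on a commutative ring `R` with `q 1 = 1` there is a MULTIPLICATIVE non-archimedean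
ring seminorm `N` (`N 1 = 1`, `N (x y) = N x · N y`, `N ≤ q`). Unlike the cited Banach-ring statements no completeness
is assumed (the proof is steps 1–3 of this file: Zorn-minimal element, smoothing, the `inf_n p₀(g fⁿ)/p₀(f)ⁿ` trick).
[cite: Kedlaya2022, Lemma 23.3.3 and Theorem 23.3.4] -/
theorem exists_mulRingSeminorm_le (q : RingSeminorm R) (hq : IsNonarchimedean q) (hq1 : q 1 = 1) :
    ∃ N : MulRingSeminorm R, IsNonarchimedean N ∧ ∀ x, N x ≤ q x := by
  obtain ⟨p₀, hna, h1, hq', hmin⟩ := exists_minimal_ringSeminorm_le q hq hq1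
  have hpm : IsPowMul p₀ := isPowMul_of_minimal hna h1 hmin
  let N : MulRingSeminorm R :=
    { toFun := p₀
      map_zero' := map_zero p₀
      add_le' := map_add_le_add p₀
      neg' := map_neg_eq_map p₀
      map_one' := h1
      map_mul' := fun x y => map_mul_of_minimal hna h1 hpm hmin x y }
  exact ⟨N, hna, hq'⟩

/-- Variant with `q 1 ≤ 1` and `q ≠ 0` (for a ring seminorm with `q 1 ≤ 1`, `q 1 = 1 ↔ q ≠ 0`, Mathlib
`RingSeminorm.seminorm_one_eq_one_iff_ne_zero`). [cite: Kedlaya2022, Theorem 23.3.4] -/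
theorem exists_mulRingSeminorm_le_of_ne_zero (q : RingSeminorm R) (hq : IsNonarchimedean q) (hq1 : q 1 ≤ 1)
    (hq0 : q ≠ 0) : ∃ N : MulRingSeminorm R, IsNonarchimedean N ∧ ∀ x, N x ≤ q x :=
  exists_mulRingSeminorm_le q hq ((q.seminorm_one_eq_one_iff_ne_zero hq1).2 hq0)

end Literature.RingTheory.Valuation

end
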